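import Literature.Probability.RandomPlanarGeometry.RadialBesselFlowMeasurable
import Literature.Probability.RandomPlanarGeometry.RadialBesselNonHitting
import Literature.Probability.RandomPlanarGeometry.RadialBesselMarkov
import Literature.Probability.RandomPlanarGeometry.StationaryAngleTimeScale
import Mathlib.Probability.Kernel.Composition.Comp
import HarnessLib

/-!
# The radial Bessel process of SLE_κ, `κ ≤ 4`: Markov property, transition kernels, generator identity

Topic `Probability/RandomPlanarGeometry`; theorems and three auxiliary definitions (`sleArg`, the
maximal SLE_κ radial Bessel flow as a named process; `pathArg`, the universal flow on the raw path
space; `sleKernel`, the transition kernels), sequel of `RadialBesselNonHitting`,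
`RadialBesselFlowMeasurable` and `RadialBesselMarkov`. For `κ ≤ 4` the SLE_κ radial Bessel process
`Y = Y^θ`, `dYₜ = cot(Yₜ/2) dt - √κ dBₜ`, from `θ ∈ (0, 2π)` lives for ever in `(0, 2π)`
(`ae_sleLifetime_eq_top`), so the maximal flow `sleArg κ θ t = arg (√κ B) θ t` IS the process at
every time. We prove:

* `sleArg_add_eq_pathArg` — **pathwise restart**: `Y^θ_{s+t} = pathArg (Y^θ_s) t (Z^s)`, the
  universal flow started from `Y^θ_s` and driven by the increments `Z^s = B_{s+·} - B_s`
  (flow property `arg_add` + dependence on increments only, `RadialBesselCocycle`);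
* `integral_sleArg_add_eq` — **the Markov property at a fixed time**, integrated form: for `X`
  `𝓕ᵂ_s`-measurable and `Ψ` bounded jointly measurable,
  `E[Ψ(X, Y^θ_{s+t})] = E_ω[E_{ω'}[Ψ(X(ω), Y^{Y^θ_s(ω)}_t(ω'))]]` (freezing formula of
  `BrownianStrongMarkov` at the constant stopping time `s`); Le Gall (2016), Thm 8.7 / Lawler
  (2005), §1.11 for this diffusion;
* `sleKernel κ t : Kernel ℝ ℝ`, `θ ↦ P[Y^θ_t ∈ ·]` (Markov kernels; `sleKernel_zero = Kernel.id`),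
  carried by `(0, 2π)` for `θ ∈ (0, 2π)` (`sleKernel_apply_Ioo`), with the **Chapman–Kolmogorov
  equation** `sleKernel (s+t) θ = (sleKernel s θ).bind (sleKernel t)` for `θ ∈ (0, 2π)`
  (`sleKernel_add_apply`), the **Feller/contraction estimates** in the starting point
  (`abs_integral_sleKernel_sub_le`: `|P_t g(θ) - P_t g(θ')| ≤ L |θ - θ'| e^{-t/2}` for
  `L`-Lipschitz bounded `g`, from the synchronous coupling `RadialBesselContraction`;
  `tendsto_integral_sleKernel`: continuity of `θ ↦ P_t g(θ)` on `(0, 2π)` for bounded continuous `g`);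
* `integral_mul_angleIncrement_sleArg_eq_zero` — **the generator identity / martingale problem**:
  for `f ∈ C²` compactly supported in `(0, 2π)`, `s ≤ t` and bounded `𝓕ᵂ_s`-measurable `G`,
  `E[G · (f(Y_t) - f(Y_s) - ∫ₛᵗ (Λ₀ f)(Y_u) du)] = 0`, `Λ₀ f = (κ/2) f'' + cot(·/2) f'`
  (`= angleGenerator κ 0 f`), from the generator martingales of `RadialBesselSLE` at the level exit
  times and `σₙ → ∞`. This is the statement that the law of `Y` solves the martingale problem of
  the SLE_κ(0) angle diffusion (Karatzas–Shreve (1988), Ch. 5 §4.B), the one-sided input for the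
  stationary angle law of `WholePlaneSLE` (Miller–Sheffield (2017), Prop. 2.1).

## References

* G. F. Lawler, *Conformally Invariant Processes in the Plane*, AMS (2005), §1.11. [Lawler2005]
* J.-F. Le Gall, *Brownian Motion, Martingales, and Stochastic Calculus* (2016), Thm 2.20, Thm 8.7.
  [Legall2016]
* J. Miller, S. Sheffield, *Imaginary geometry IV*, PTRF 169 (2017), arXiv:1302.4738, §2.1.2,
  Prop. 2.1. [MillerSheffield2013]
* I. Karatzas, S. Shreve, *Brownian Motion and Stochastic Calculus* (1988), Ch. 5 §4.B.
  [KaratzasShreve1988]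
-/

noncomputable section

open MeasureTheory ProbabilityTheory Filter Topology Set
open scoped NNReal ENNReal

namespace Literature.Probability.RandomPlanarGeometry

namespace RadialLoewner

open Literature.Probability.Process Literature.Analysis.FunctionSpaces

/-! ### The maximal SLE_κ radial Bessel flow and the universal flow on path space -/

section Defs

/-- **The SLE_κ radial Bessel process** `Y^θ_t(ω)` from `θ` on the canonical space: the maximal
flow `arg` of `√κ B` (LSW (2002), (2.9)–(2.11); Lawler (2005), (1.16), (6.12)); junk `0` from the
lifetime on. [cite: LawlerSchrammWernerEJP2002, §2 (2.9)–(2.11)] -/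
abbrev sleArg (κ : ℝ≥0) (θ : ℝ) (t : ℝ≥0) (ω : ℝ≥0 → ℝ) : ℝ :=
  arg (sleDriving κ) (continuous_sleDriving' κ) θ t ω

/-- **The universal radial Bessel flow on the raw path space** `ℝ≥0 → ℝ`: the maximal flow driven
by `√κ ×` the regularised path (`pathDriving`), so that it is jointly measurable in the raw path and
agrees with `sleArg` on Brownian paths. [folklore] -/
abbrev pathArg (κ : ℝ≥0) (y : ℝ) (t : ℝ≥0) (w : ℝ≥0 → ℝ) : ℝ :=
  arg (pathDriving κ) (continuous_pathDriving κ) y t w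

variable (κ : ℝ≥0)

/-- `(θ, ω) ↦ Y^θ_t(ω)` is jointly measurable. [folklore] -/
theorem measurable_sleArg_prod (t : ℝ≥0) : Measurable fun p : ℝ × (ℝ≥0 → ℝ) ↦ sleArg κ p.1 t p.2 :=
  measurable_arg_prod (continuous_sleDriving' κ) (measurable_sleDriving_apply κ) t

/-- `ω ↦ Y^θ_t(ω)` is measurable. [folklore] -/
theorem measurable_sleArg (θ : ℝ) (t : ℝ≥0) : Measurable (sleArg κ θ t) :=
  measurable_arg (continuous_sleDriving' κ) (measurable_sleDriving_apply κ) θ t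

/-- `(t, ω) ↦ Y^θ_t(ω)` is jointly measurable. [folklore] -/
theorem measurable_sleArg_time (θ : ℝ) : Measurable fun q : ℝ≥0 × (ℝ≥0 → ℝ) ↦ sleArg κ θ q.1 q.2 :=
  measurable_arg_time (continuous_sleDriving' κ) (measurable_sleDriving_apply κ) θ

/-- `(t, θ, ω) ↦ Y^θ_t(ω)` is jointly measurable. [folklore] -/
theorem measurable_sleArg_uncurry₃ :
    Measurable fun q : ℝ≥0 × (ℝ × (ℝ≥0 → ℝ)) ↦ sleArg κ q.2.1 q.1 q.2.2 :=
  measurable_arg_uncurry₃ (continuous_sleDriving' κ) (measurable_sleDriving_apply κ)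

/-- `Y^θ_t` is `𝓕ᵂ_t`-measurable (raw Brownian filtration). [folklore] -/
theorem measurable_sleArg_filtration (θ : ℝ) (t : ℝ≥0) :
    Measurable[brownianFiltration t] (sleArg κ θ t) :=
  measurable_arg_filtration (continuous_sleDriving' κ) (measurable_sleDriving_filtration κ) θ t

/-- `(y, w) ↦ pathArg y t w` is jointly measurable in the start and the raw path. [folklore] -/
theorem measurable_pathArg_prod (t : ℝ≥0) : Measurable fun p : ℝ × (ℝ≥0 → ℝ) ↦ pathArg κ p.1 t p.2 :=
  measurable_arg_prod (continuous_pathDriving κ) (measurable_pathDriving κ) t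

/-- **On a Brownian path the universal flow is the SLE_κ process.** [folklore] -/
theorem pathArg_brownian (y : ℝ) (t : ℝ≥0) (ω : ℝ≥0 → ℝ) :
    pathArg κ y t (fun u ↦ brownian u ω) = sleArg κ y t ω :=
  arg_congr (continuous_sleDriving' κ) (continuous_pathDriving κ) (pathDriving_brownian_sub κ ω) y t

/-- The flow starts at `θ`. [folklore] -/
@[simp] theorem sleArg_zero (θ : ℝ) (ω : ℝ≥0 → ℝ) : sleArg κ θ 0 ω = θ := arg_zero _ θ ω

end Defs

variable {κ : ℝ≥0} {θ : ℝ}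

/-! ### Pathwise restart at a fixed time -/

/-- **Pathwise restart identity**: before the lifetime, `Y^θ_{s+t} = pathArg (Y^θ_s) t (Z^s)` with
`Z^s_u = B_{s+u} - B_s` the Brownian increments after `s` (flow property, and dependence of the
flow on the increments of the driving path only). [folklore] -/
theorem sleArg_add_eq_pathArg {ω : ℝ≥0 → ℝ} {s t : ℝ≥0}
    (hst : ((s + t : ℝ≥0) : WithTop ℝ≥0) < sleLifetime κ θ ω) :
    sleArg κ θ (s + t) ω =
      pathArg κ (sleArg κ θ s ω) t (fun u ↦ brownianIncrAfter (fun _ ↦ (s : WithTop ℝ≥0)) u ω) := by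
  obtain ⟨N, hN⟩ := eventually_lt_exitLevel (continuous_sleDriving' κ) hst
  have h1 := arg_add (continuous_sleDriving' κ) θ ω (hN N le_rfl).le
  rw [sleArg, h1, pathArg]
  symm
  exact arg_congr (continuous_shiftFam (continuous_sleDriving' κ) s) (continuous_pathDriving κ)
    (fun u ↦ pathDriving_brownianIncrAfter_sub (κ := κ) (ρ := fun _ ↦ (s : WithTop ℝ≥0)) rfl u) _ t

/-! ### The Markov property at a fixed time -/

/-- **Markov property of the SLE_κ radial Bessel process at a fixed time `s`** (`κ ≤ 4`,
`θ ∈ (0, 2π)`), integrated form: for an `𝓕ᵂ_s`-measurable `X` and a bounded jointly measurable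
`Ψ`, `E[Ψ(X, Y^θ_{s+t})] = E_ω[E_{ω'}[Ψ(X(ω), Y^{Y^θ_s(ω)}_t(ω'))]]` — conditionally on `𝓕ᵂ_s`
the process restarts from `Y^θ_s` driven by a fresh Brownian motion. Le Gall (2016), Thm 8.7;
Lawler (2005), §1.11. [cite: Legall2016, Thm. 8.7] -/
theorem integral_sleArg_add_eq (hκ : κ ≤ 4) (hθ : θ ∈ Ioo 0 (2 * Real.pi)) (s t : ℝ≥0)
    {𝒳 : Type*} [MeasurableSpace 𝒳] {X : (ℝ≥0 → ℝ) → 𝒳} (hX : Measurable[brownianFiltration s] X)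
    {Ψ : 𝒳 → ℝ → ℝ} (hΨm : Measurable (Function.uncurry Ψ)) {C : ℝ} (hΨb : ∀ x y, |Ψ x y| ≤ C) :
    ∫ ω, Ψ (X ω) (sleArg κ θ (s + t) ω) ∂preWienerMeasure =
      ∫ ω, (∫ ω', Ψ (X ω) (sleArg κ (sleArg κ θ s ω) t ω') ∂preWienerMeasure) ∂preWienerMeasure := by
  haveI := isProbabilityMeasure_preWienerMeasure'
  set τ : (ℝ≥0 → ℝ) → WithTop ℝ≥0 := fun _ ↦ (s : WithTop ℝ≥0) with hτdef
  have hτ : IsStoppingTime brownianFiltration τ := isStoppingTime_const _ _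
  have hfin : ∀ᵐ ω ∂preWienerMeasure, τ ω ≠ ⊤ := Eventually.of_forall fun _ ↦ WithTop.coe_ne_top
  -- the frozen data `(X, Y_s)` is `𝓕_s`-measurable
  have hXh : Measurable[hτ.measurableSpace] (fun ω ↦ (X ω, sleArg κ θ s ω)) := by
    rw [IsStoppingTime.measurableSpace_const]
    exact hX.prodMk (measurable_sleArg_filtration κ θ s)
  have hFm : Measurable (Function.uncurry fun (x : 𝒳 × ℝ) (w : ℝ≥0 → ℝ) ↦ Ψ x.1 (pathArg κ x.2 t w)) :=
    hΨm.comp (measurable_fst.fst.prodMk ((measurable_pathArg_prod κ t).comp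
      (measurable_fst.snd.prodMk measurable_snd)))
  have hFb : ∀ (x : 𝒳 × ℝ) (w : ℝ≥0 → ℝ), |Ψ x.1 (pathArg κ x.2 t w)| ≤ C := fun x w ↦ hΨb _ _
  -- (1) pathwise restart, almost surely
  have hae : (fun ω ↦ Ψ (X ω) (sleArg κ θ (s + t) ω)) =ᵐ[preWienerMeasure] fun ω ↦
      Ψ (X ω) (pathArg κ (sleArg κ θ s ω) t fun u ↦ brownianIncrAfter τ u ω) := by
    filter_upwards [ae_sleLifetime_eq_top hκ hθ] with ω hω
    rw [sleArg_add_eq_pathArg (by rw [hω]; exact WithTop.coe_lt_top _)]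
  -- (2) freezing at `s`; (3) on a Brownian path the universal flow is the SLE_κ process
  rw [integral_congr_ae hae, integral_brownianIncrAfter_eq_integral_integral hτ hfin hXh hFm hFb]
  simp only [pathArg_brownian]

/-! ### The transition kernels -/

section Kernel

variable (κ)

/-- **The transition kernel of the SLE_κ radial Bessel process**: `sleKernel κ t θ = P[Y^θ_t ∈ ·]`,
a Markov kernel on `ℝ` (honest for `θ ∈ (0, 2π)`, `κ ≤ 4`; for other starts it is the law of the
junk flow). [folklore] -/
def sleKernel (t : ℝ≥0) : Kernel ℝ ℝ where
  toFun θ := preWienerMeasure.map (sleArg κ θ t)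
  measurable' := by
    refine Measure.measurable_of_measurable_coe _ fun A hA ↦ ?_
    have h : (fun θ ↦ preWienerMeasure.map (sleArg κ θ t) A) =
        fun θ ↦ preWienerMeasure (Prod.mk θ ⁻¹' {p : ℝ × (ℝ≥0 → ℝ) | sleArg κ p.1 t p.2 ∈ A}) := by
      funext θ
      rw [Measure.map_apply (measurable_sleArg κ θ t) hA]
      rfl
    rw [h]
    exact measurable_measure_prodMk_left (measurable_sleArg_prod κ t hA)

/-- The kernel at `θ` is the law of `Y^θ_t`. [folklore] -/
theorem sleKernel_apply (t : ℝ≥0) (θ : ℝ) : sleKernel κ t θ = preWienerMeasure.map (sleArg κ θ t) := rfl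

/-- The transition kernels are Markov kernels. [folklore] -/
instance isMarkovKernel_sleKernel (t : ℝ≥0) : IsMarkovKernel (sleKernel κ t) := by
  haveI := isProbabilityMeasure_preWienerMeasure'
  exact ⟨fun θ ↦ by rw [sleKernel_apply]; exact Measure.isProbabilityMeasure_map (measurable_sleArg κ θ t).aemeasurable⟩

/-- Integration against the kernel: `∫ g d(P_t(θ, ·)) = E[g(Y^θ_t)]`. [folklore] -/
theorem integral_sleKernel (t : ℝ≥0) (θ : ℝ) {g : ℝ → ℝ} (hg : AEStronglyMeasurable g (sleKernel κ t θ)) :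
    ∫ y, g y ∂(sleKernel κ t θ) = ∫ ω, g (sleArg κ θ t ω) ∂preWienerMeasure := by
  rw [sleKernel_apply] at hg ⊢
  exact integral_map (measurable_sleArg κ θ t).aemeasurable hg

/-- Lower integration against the kernel. [folklore] -/
theorem lintegral_sleKernel (t : ℝ≥0) (θ : ℝ) {g : ℝ → ℝ≥0∞} (hg : Measurable g) :
    ∫⁻ y, g y ∂(sleKernel κ t θ) = ∫⁻ ω, g (sleArg κ θ t ω) ∂preWienerMeasure := by
  rw [sleKernel_apply, lintegral_map hg (measurable_sleArg κ θ t)]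

/-- Measure of a set under the kernel. [folklore] -/
theorem sleKernel_apply_set (t : ℝ≥0) (θ : ℝ) {A : Set ℝ} (hA : MeasurableSet A) :
    sleKernel κ t θ A = preWienerMeasure (sleArg κ θ t ⁻¹' A) := by
  rw [sleKernel_apply, Measure.map_apply (measurable_sleArg κ θ t) hA]

/-- At time `0` the kernel is the identity. [folklore] -/
theorem sleKernel_zero : sleKernel κ 0 = Kernel.id := by
  haveI := isProbabilityMeasure_preWienerMeasure'
  ext θ : 1
  rw [sleKernel_apply, Kernel.id_apply]
  have : sleArg κ θ 0 = fun _ ↦ θ := funext fun ω ↦ sleArg_zero κ θ ω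
  rw [this, Measure.map_const, measure_univ, one_smul]

variable {κ}

/-- **The kernels from `θ ∈ (0, 2π)` are carried by `(0, 2π)`** (`κ ≤ 4`: no hitting).
[folklore] -/
theorem sleKernel_apply_Ioo (hκ : κ ≤ 4) (hθ : θ ∈ Ioo 0 (2 * Real.pi)) (t : ℝ≥0) :
    sleKernel κ t θ (Ioo 0 (2 * Real.pi)) = 1 := by
  haveI := isProbabilityMeasure_preWienerMeasure'
  rw [sleKernel_apply_set κ t θ measurableSet_Ioo]
  have h : ∀ᵐ ω ∂preWienerMeasure, ω ∈ sleArg κ θ t ⁻¹' Ioo 0 (2 * Real.pi) := by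
    filter_upwards [ae_forall_sleArg_mem_Ioo hκ hθ] with ω hω
    exact hω t
  have h0 : preWienerMeasure (sleArg κ θ t ⁻¹' Ioo 0 (2 * Real.pi))ᶜ = 0 := ae_iff.1 h
  exact (prob_compl_eq_zero_iff (measurable_sleArg κ θ t measurableSet_Ioo)).1 h0

/-- **Chapman–Kolmogorov** for the SLE_κ radial Bessel kernels from `θ ∈ (0, 2π)` (`κ ≤ 4`):
`P_{s+t}(θ, ·) = ∫ P_t(y, ·) P_s(θ, dy)` (the Markov property at time `s` on indicators).
[cite: Legall2016, Thm. 8.7] -/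
theorem sleKernel_add_apply (hκ : κ ≤ 4) (hθ : θ ∈ Ioo 0 (2 * Real.pi)) (s t : ℝ≥0) :
    sleKernel κ (s + t) θ = (sleKernel κ s θ).bind (sleKernel κ t) := by
  haveI := isProbabilityMeasure_preWienerMeasure'
  ext A hA
  rw [Measure.bind_apply hA (Kernel.aemeasurable _), lintegral_sleKernel κ s θ (Kernel.measurable_coe _ hA),
    sleKernel_apply_set κ (s + t) θ hA]
  -- Markov property on the indicator of `A`
  have hM := integral_sleArg_add_eq hκ hθ s t (𝒳 := ℝ) (X := fun _ ↦ (0 : ℝ))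
    (@measurable_const _ _ _ (brownianFiltration s) (0 : ℝ))
    (Ψ := fun _ y ↦ A.indicator (fun _ ↦ (1 : ℝ)) y)
    ((measurable_const.indicator hA).comp measurable_snd) (C := 1)
    (fun _ y ↦ by by_cases hy : y ∈ A <;> simp [hy])
  -- rewrite both sides as real numbers
  have hL : (preWienerMeasure (sleArg κ θ (s + t) ⁻¹' A)).toReal =
      ∫ ω, A.indicator (fun _ ↦ (1 : ℝ)) (sleArg κ θ (s + t) ω) ∂preWienerMeasure := by
    rw [← measureReal_def, ← integral_indicator_one (measurable_sleArg κ θ (s + t) hA)]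
    rfl
  have hR : ∀ y, ∫ ω', A.indicator (fun _ ↦ (1 : ℝ)) (sleArg κ y t ω') ∂preWienerMeasure =
      (sleKernel κ t y A).toReal := fun y ↦ by
    rw [sleKernel_apply_set κ t y hA, ← measureReal_def,
      ← integral_indicator_one (measurable_sleArg κ y t hA)]
    rfl
  simp_rw [hR] at hM
  rw [← hL] at hM
  -- pass to `ℝ≥0∞`
  have hfin : ∀ y, sleKernel κ t y A ≠ ∞ := fun y ↦ measure_ne_top _ _
  have hint : ∫ ω, (sleKernel κ t (sleArg κ θ s ω) A).toReal ∂preWienerMeasure =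
      (∫⁻ ω, sleKernel κ t (sleArg κ θ s ω) A ∂preWienerMeasure).toReal := by
    rw [integral_toReal]
    · exact ((Kernel.measurable_coe _ hA).comp (measurable_sleArg κ θ s)).aemeasurable
    · exact Eventually.of_forall fun ω ↦ (measure_lt_top _ _)
  rw [hint] at hM
  have hne : ∫⁻ ω, sleKernel κ t (sleArg κ θ s ω) A ∂preWienerMeasure ≠ ∞ := by
    refine ne_top_of_le_ne_top (b := ∫⁻ _, 1 ∂preWienerMeasure) (by simp) ?_
    exact lintegral_mono fun ω ↦ prob_le_one
  exact (ENNReal.toReal_eq_toReal_iff' (measure_ne_top _ _) hne).1 hM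

/-- **The kernel action of a measurable function is measurable**: `θ ↦ E[g(Y^θ_t)]`.
[folklore] -/
theorem measurable_integral_sleArg (t : ℝ≥0) {g : ℝ → ℝ} (hg : Measurable g) :
    Measurable fun θ ↦ ∫ ω, g (sleArg κ θ t ω) ∂preWienerMeasure := by
  have h : (fun θ ↦ ∫ ω, g (sleArg κ θ t ω) ∂preWienerMeasure) = fun θ ↦ ∫ y, g y ∂(sleKernel κ t θ) := by
    funext θ; rw [integral_sleKernel κ t θ hg.aestronglyMeasurable]
  rw [h]
  exact (hg.stronglyMeasurable.integral_kernel (κ := sleKernel κ t)).measurable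

/-- The clamp `x ↦ (x ∨ -C) ∧ C` to `[-C, C]`. [folklore] -/
theorem clamp_eq_self {C x : ℝ} (hx : |x| ≤ C) : min (max x (-C)) C = x := by
  rw [abs_le] at hx
  rw [max_eq_left hx.1, min_eq_left hx.2]

/-- The clamp is bounded by `C` (`0 ≤ C`). [folklore] -/
theorem abs_clamp_le {C : ℝ} (hC : 0 ≤ C) (x : ℝ) : |min (max x (-C)) C| ≤ C := by
  rw [abs_le]
  exact ⟨le_min (le_max_right _ _) (by linarith), min_le_right _ _⟩

/-- **Markov property with a bounded test function**: for bounded `𝓕ᵂ_s`-measurable `G` and bounded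
measurable `g`, `E[G · g(Y^θ_{s+t})] = E[G · (P_t g)(Y^θ_s)]` (`θ ∈ (0, 2π)`, `κ ≤ 4`).
[cite: Legall2016, Thm. 8.7] -/
theorem integral_mul_apply_sleArg_add_eq (hκ : κ ≤ 4) (hθ : θ ∈ Ioo 0 (2 * Real.pi)) (s t : ℝ≥0)
    {G : (ℝ≥0 → ℝ) → ℝ} (hG : Measurable[brownianFiltration s] G) {CG : ℝ} (hGb : ∀ ω, |G ω| ≤ CG)
    {g : ℝ → ℝ} (hg : Measurable g) {Cg : ℝ} (hgb : ∀ y, |g y| ≤ Cg) :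
    ∫ ω, G ω * g (sleArg κ θ (s + t) ω) ∂preWienerMeasure =
      ∫ ω, G ω * (∫ ω', g (sleArg κ (sleArg κ θ s ω) t ω') ∂preWienerMeasure) ∂preWienerMeasure := by
  have hCG : 0 ≤ CG := (abs_nonneg _).trans (hGb (fun _ ↦ 0))
  have hCg : 0 ≤ Cg := (abs_nonneg _).trans (hgb 0)
  -- clamp the frozen weight so that the integrand is bounded for every value of the parameter
  have h := integral_sleArg_add_eq hκ hθ s t (X := G) hG (Ψ := fun x y ↦ min (max x (-CG)) CG * g y)
    (((measurable_fst.max measurable_const).min measurable_const).mul (hg.comp measurable_snd))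
    (C := CG * Cg) (fun x y ↦ by
      rw [abs_mul]; exact mul_le_mul (abs_clamp_le hCG x) (hgb y) (abs_nonneg _) hCG)
  simp only [clamp_eq_self (hGb _)] at h
  simpa [integral_const_mul] using h

end Kernel

/-! ### Contraction and continuity in the starting point -/

section Feller

/-- **Contraction of the kernels in the starting point**: for a bounded `L`-Lipschitz `g` and
`θ, θ' ∈ (0, 2π)`, `|E g(Y^θ_t) - E g(Y^{θ'}_t)| ≤ L |θ - θ'| e^{-t/2}` (`κ ≤ 4`; synchronous
coupling, `RadialBesselContraction`). Miller–Sheffield (2017), Prop. 2.1 (coupling with exponential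
rate). [cite: MillerSheffield2013, Prop. 2.1] -/
theorem abs_integral_sleArg_sub_le (hκ : κ ≤ 4) {θ θ' : ℝ} (hθ : θ ∈ Ioo 0 (2 * Real.pi))
    (hθ' : θ' ∈ Ioo 0 (2 * Real.pi)) (t : ℝ≥0) {g : ℝ → ℝ} (hg : Measurable g) {C : ℝ}
    (hgb : ∀ y, |g y| ≤ C) {L : ℝ≥0} (hgL : LipschitzWith L g) :
    |∫ ω, g (sleArg κ θ t ω) ∂preWienerMeasure - ∫ ω, g (sleArg κ θ' t ω) ∂preWienerMeasure| ≤
      L * |θ - θ'| * Real.exp (-(t : ℝ) / 2) := by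
  haveI := isProbabilityMeasure_preWienerMeasure'
  have hi : ∀ θ, Integrable (fun ω ↦ g (sleArg κ θ t ω)) preWienerMeasure := fun θ ↦
    Integrable.mono' (integrable_const C) ((hg.comp (measurable_sleArg κ θ t)).aestronglyMeasurable)
      (Eventually.of_forall fun ω ↦ by simpa [Real.norm_eq_abs] using hgb _)
  rw [← integral_sub (hi θ) (hi θ')]
  have hbound : ∀ᵐ ω ∂preWienerMeasure, |g (sleArg κ θ t ω) - g (sleArg κ θ' t ω)| ≤
      L * |θ - θ'| * Real.exp (-(t : ℝ) / 2) := by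
    filter_upwards [ae_sleLifetime_eq_top hκ hθ, ae_sleLifetime_eq_top hκ hθ'] with ω hT hT'
    have hcontr := abs_arg_sub_arg_le_mul_exp_of_lifetime_eq_top (continuous_sleDriving' κ) hT' hT t
    calc |g (sleArg κ θ t ω) - g (sleArg κ θ' t ω)| ≤ L * |sleArg κ θ t ω - sleArg κ θ' t ω| := by
          rw [← Real.dist_eq, ← Real.dist_eq]; exact hgL.dist_le_mul _ _
      _ ≤ L * (|θ - θ'| * Real.exp (-(t : ℝ) / 2)) := mul_le_mul_of_nonneg_left hcontr L.coe_nonneg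
      _ = L * |θ - θ'| * Real.exp (-(t : ℝ) / 2) := by ring
  calc |∫ ω, g (sleArg κ θ t ω) - g (sleArg κ θ' t ω) ∂preWienerMeasure|
      ≤ ∫ ω, |g (sleArg κ θ t ω) - g (sleArg κ θ' t ω)| ∂preWienerMeasure := abs_integral_le_integral_abs
    _ ≤ ∫ ω, L * |θ - θ'| * Real.exp (-(t : ℝ) / 2) ∂preWienerMeasure :=
        integral_mono_ae ((hi θ).sub (hi θ')).abs (integrable_const _) hbound
    _ = L * |θ - θ'| * Real.exp (-(t : ℝ) / 2) := by rw [integral_const, probReal_univ, one_smul]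

/-- **Continuity of the kernel action in the starting point** (Feller property on `(0, 2π)`): for a
bounded continuous `g` and a sequence `θₘ → θ` in `(0, 2π)`, `E g(Y^{θₘ}_t) → E g(Y^θ_t)` (a.s.
`|Y^{θₘ}_t - Y^θ_t| ≤ |θₘ - θ|`, dominated convergence). [folklore] -/
theorem tendsto_integral_sleArg (hκ : κ ≤ 4) {θ : ℝ} (hθ : θ ∈ Ioo 0 (2 * Real.pi))
    {u : ℕ → ℝ} (hu : ∀ m, u m ∈ Ioo 0 (2 * Real.pi)) (hlim : Tendsto u atTop (𝓝 θ)) (t : ℝ≥0)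
    {g : ℝ → ℝ} (hgm : Measurable g) (hg : ContinuousOn g (Ioo 0 (2 * Real.pi))) {C : ℝ}
    (hgb : ∀ y, |g y| ≤ C) :
    Tendsto (fun m ↦ ∫ ω, g (sleArg κ (u m) t ω) ∂preWienerMeasure) atTop
      (𝓝 (∫ ω, g (sleArg κ θ t ω) ∂preWienerMeasure)) := by
  haveI := isProbabilityMeasure_preWienerMeasure'
  refine tendsto_integral_of_dominated_convergence (fun _ ↦ C)
    (fun m ↦ (hgm.comp (measurable_sleArg κ (u m) t)).aestronglyMeasurable)
    (integrable_const C) (fun m ↦ Eventually.of_forall fun ω ↦ by simpa [Real.norm_eq_abs] using hgb _) ?_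
  have hall : ∀ᵐ ω ∂preWienerMeasure, ∀ m, sleLifetime κ (u m) ω = ⊤ := by
    rw [ae_all_iff]; exact fun m ↦ ae_sleLifetime_eq_top hκ (hu m)
  filter_upwards [hall, ae_sleLifetime_eq_top hκ hθ] with ω hω hT
  -- all values live in `(0, 2π)`, where `g` is continuous
  have hmemθ : sleArg κ θ t ω ∈ Ioo 0 (2 * Real.pi) :=
    arg_mem_Ioo (continuous_sleDriving' κ) hθ (by
      change (t : WithTop ℝ≥0) < sleLifetime κ θ ω; rw [hT]; exact WithTop.coe_lt_top t)
  have hmemu : ∀ m, sleArg κ (u m) t ω ∈ Ioo 0 (2 * Real.pi) := fun m ↦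
    arg_mem_Ioo (continuous_sleDriving' κ) (hu m) (by
      change (t : WithTop ℝ≥0) < sleLifetime κ (u m) ω; rw [hω m]; exact WithTop.coe_lt_top t)
  refine ((hg _ hmemθ).tendsto).comp (tendsto_nhdsWithin_iff.2 ⟨?_, Eventually.of_forall hmemu⟩)
  -- `|Y^{uₘ}_t - Y^θ_t| ≤ |uₘ - θ| → 0`
  have hle : ∀ m, |sleArg κ (u m) t ω - sleArg κ θ t ω| ≤ |u m - θ| := fun m ↦ by
    have h := abs_arg_sub_arg_le_mul_exp_of_lifetime_eq_top (continuous_sleDriving' κ) hT (hω m) t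
    refine h.trans ?_
    have hexp : Real.exp (-(t : ℝ) / 2) ≤ 1 := by
      rw [Real.exp_le_one_iff]; have := t.coe_nonneg; linarith
    calc |u m - θ| * Real.exp (-(t : ℝ) / 2) ≤ |u m - θ| * 1 :=
          mul_le_mul_of_nonneg_left hexp (abs_nonneg _)
      _ = |u m - θ| := mul_one _
  rw [tendsto_iff_norm_sub_tendsto_zero]
  have h0 : Tendsto (fun m ↦ |u m - θ|) atTop (𝓝 0) := by
    have := (tendsto_iff_norm_sub_tendsto_zero.1 hlim)
    simpa [Real.norm_eq_abs] using this
  exact squeeze_zero (fun m ↦ norm_nonneg _) (fun m ↦ by rw [Real.norm_eq_abs]; exact hle m) h0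

end Feller

/-! ### The generator identity (one-sided martingale problem) -/

section Generator

/-- `Λ₀ f = angleGenerator κ 0 f` (`(κ/2) f'' + cot(·/2) f'`). [folklore] -/
theorem expGenerator_zero_eq_angleGenerator (κ : ℝ≥0) (f : ℝ → ℝ) (y : ℝ) :
    expGenerator κ 0 f y = angleGenerator κ 0 f y := by
  rw [expGenerator_apply, angleGenerator]; ring

variable {n : ℕ}

/-- The generator martingale increment has zero mean against bounded `𝓕ᵂ_s`-measurable weights
(level `n`, `μ = 0`). [folklore] -/
theorem integral_mul_sub_levelMartingale_eq_zero
    (hθn : θ ∈ Ioo (2 * level n) (2 * Real.pi - 2 * level n)) {f : ℝ → ℝ} (hf : ContDiff ℝ 2 f)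
    {s t : ℝ≥0} (hst : s ≤ t) {G : (ℝ≥0 → ℝ) → ℝ} (hG : Measurable[brownianFiltration s] G) {CG : ℝ}
    (hGb : ∀ ω, |G ω| ≤ CG) :
    ∫ ω, G ω * ((f (stoppedProcess (sleArgLevel κ n θ) (sleExitLevel κ n θ) t ω) -
        ∫ u in (0 : ℝ)..t, genDrift κ n θ 0 f u.toNNReal ω) -
      (f (stoppedProcess (sleArgLevel κ n θ) (sleExitLevel κ n θ) s ω) -
        ∫ u in (0 : ℝ)..s, genDrift κ n θ 0 f u.toNNReal ω)) ∂preWienerMeasure = 0 := by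
  haveI := isProbabilityMeasure_preWienerMeasure'
  have hM := martingale_expGenerator_sleArgLevel (κ := κ) hθn hf 0
  set M : ℝ≥0 → (ℝ≥0 → ℝ) → ℝ := fun t ω ↦ expClock κ n θ 0 t ω *
    f (stoppedProcess (sleArgLevel κ n θ) (sleExitLevel κ n θ) t ω) -
    ∫ u in (0 : ℝ)..t, genDrift κ n θ 0 f u.toNNReal ω with hMdef
  have hM1 : ∀ r ω, M r ω = f (stoppedProcess (sleArgLevel κ n θ) (sleExitLevel κ n θ) r ω) -
      ∫ u in (0 : ℝ)..r, genDrift κ n θ 0 f u.toNNReal ω := fun r ω ↦ by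
    simp only [hMdef, expClock_apply, zero_mul, Real.exp_zero, one_mul]
  have heq : (fun ω ↦ G ω * ((f (stoppedProcess (sleArgLevel κ n θ) (sleExitLevel κ n θ) t ω) -
        ∫ u in (0 : ℝ)..t, genDrift κ n θ 0 f u.toNNReal ω) -
      (f (stoppedProcess (sleArgLevel κ n θ) (sleExitLevel κ n θ) s ω) -
        ∫ u in (0 : ℝ)..s, genDrift κ n θ 0 f u.toNNReal ω))) = fun ω ↦ G ω * (M t ω - M s ω) := by
    funext ω; rw [hM1, hM1]
  rw [heq]
  -- orthogonality of martingale differences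
  set ξ : (ℝ≥0 → ℝ) → ℝ := fun ω ↦ M t ω - M s ω with hξdef
  have hξ : Integrable ξ preWienerMeasure := (hM.integrable t).sub (hM.integrable s)
  have hGs : StronglyMeasurable[brownianFiltration s] G := hG.stronglyMeasurable
  have hGm : AEStronglyMeasurable G preWienerMeasure :=
    (hG.mono (brownianFiltration.le s) le_rfl).aestronglyMeasurable
  have hGξ : Integrable (G * ξ) preWienerMeasure := by
    have h := Integrable.bdd_mul (c := CG) hξ hGm (Eventually.of_forall fun ω ↦
      (show ‖G ω‖ ≤ CG by simpa [Real.norm_eq_abs] using hGb ω))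
    exact h
  have h0 : preWienerMeasure[ξ | brownianFiltration s] =ᵐ[preWienerMeasure] 0 := by
    have h1 := hM.condExp_ae_eq hst
    have h2 : preWienerMeasure[ξ | brownianFiltration s] =ᵐ[preWienerMeasure]
        preWienerMeasure[M t | brownianFiltration s] - preWienerMeasure[M s | brownianFiltration s] :=
      condExp_sub (hM.integrable t) (hM.integrable s) _
    have h3 : preWienerMeasure[M s | brownianFiltration s] = M s :=
      condExp_of_stronglyMeasurable (brownianFiltration.le s) (hM.1 s) (hM.integrable s)
    filter_upwards [h1, h2] with ω hω1 hω2
    rw [hω2, Pi.sub_apply, hω1, h3, sub_self, Pi.zero_apply]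
  -- `E[G ξ] = E[E[G ξ | 𝓕_s]] = E[G E[ξ|𝓕_s]] = 0`
  have h1 : ∫ ω, (G * ξ) ω ∂preWienerMeasure =
      ∫ ω, (preWienerMeasure[G * ξ | brownianFiltration s]) ω ∂preWienerMeasure :=
    (integral_condExp (brownianFiltration.le s)).symm
  have h2 := condExp_mul_of_stronglyMeasurable_left (μ := preWienerMeasure) hGs hGξ hξ
  have h3 : ∫ ω, (preWienerMeasure[G * ξ | brownianFiltration s]) ω ∂preWienerMeasure =
      ∫ ω, (0 : ℝ) ∂preWienerMeasure := by
    refine integral_congr_ae ?_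
    filter_upwards [h2, h0] with ω hω hω'
    rw [hω, Pi.mul_apply, hω', Pi.zero_apply, mul_zero]
  have h4 : ∫ ω, G ω * (M t ω - M s ω) ∂preWienerMeasure = ∫ ω, (G * ξ) ω ∂preWienerMeasure := rfl
  rw [h4, h1, h3, integral_zero]

/-- **The generator identity for the SLE_κ radial Bessel process** (`κ ≤ 4`, `θ ∈ (0, 2π)`): for
`f ∈ C²` compactly supported in `(0, 2π)`, `s ≤ t` and a bounded `𝓕ᵂ_s`-measurable weight `G`,

  `E[G · (f(Y_t) - f(Y_s) - ∫ₛᵗ (Λ₀ f)(Y_u) du)] = 0`,  `Λ₀ f = (κ/2) f'' + cot(·/2) f'`,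

i.e. `f(Yₜ) - ∫₀ᵗ Λ₀f(Y_u) du` is an `𝓕ᵂ`-martingale: the law of `Y` solves the martingale problem
for the SLE_κ(0) angle generator (Karatzas–Shreve (1988), Ch. 5 §4.B). Obtained from the level-`n`
generator martingales (`RadialBesselSLE`) as `σₙ → ∞` (dominated convergence). [cite: KaratzasShreve1988, Ch. 5 §4.B] -/
theorem integral_mul_angleIncrement_sleArg_eq_zero (hκ : κ ≤ 4) (hθ : θ ∈ Ioo 0 (2 * Real.pi))
    {f : ℝ → ℝ} (hf : ContDiff ℝ 2 f) (hfc : HasCompactSupport f)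
    (hsupp : tsupport f ⊆ Ioo 0 (2 * Real.pi)) {s t : ℝ≥0} (hst : s ≤ t)
    {G : (ℝ≥0 → ℝ) → ℝ} (hG : Measurable[brownianFiltration s] G) {CG : ℝ} (hGb : ∀ ω, |G ω| ≤ CG) :
    ∫ ω, G ω * (f (sleArg κ θ t ω) - f (sleArg κ θ s ω) -
      ∫ u in (s : ℝ)..t, angleGenerator κ 0 f (sleArg κ θ u.toNNReal ω)) ∂preWienerMeasure = 0 := by
  haveI := isProbabilityMeasure_preWienerMeasure'
  obtain ⟨N₀, hN₀⟩ := eventually_mem_Ioo_level hθ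
  obtain ⟨Cf, hCf0, hCf⟩ := exists_bound_of_hasCompactSupport hf.continuous hfc
  obtain ⟨CL, hCL0, hCL⟩ := exists_bound_angleGenerator (κ := κ) (ρ := 0) hf hfc hsupp
  have hCG : 0 ≤ CG := (abs_nonneg _).trans (hGb fun _ ↦ 0)
  have hLcont : Continuous (angleGenerator κ 0 f) := continuous_angleGenerator hf hsupp
  -- the level-`n` observables and their limit
  set Φ : ℕ → (ℝ≥0 → ℝ) → ℝ := fun n ω ↦ G ω * ((f (stoppedProcess (sleArgLevel κ n θ) (sleExitLevel κ n θ) t ω) -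
        ∫ u in (0 : ℝ)..t, genDrift κ n θ 0 f u.toNNReal ω) -
      (f (stoppedProcess (sleArgLevel κ n θ) (sleExitLevel κ n θ) s ω) -
        ∫ u in (0 : ℝ)..s, genDrift κ n θ 0 f u.toNNReal ω)) with hΦdef
  set Φlim : (ℝ≥0 → ℝ) → ℝ := fun ω ↦ G ω * (f (sleArg κ θ t ω) - f (sleArg κ θ s ω) -
      ∫ u in (s : ℝ)..t, angleGenerator κ 0 f (sleArg κ θ u.toNNReal ω)) with hΦlimdef
  have hzero : ∀ n, N₀ ≤ n → ∫ ω, Φ n ω ∂preWienerMeasure = 0 := fun n hn ↦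
    integral_mul_sub_levelMartingale_eq_zero (hN₀ n hn) hf hst hG hGb
  -- domination: `|Φₙ| ≤ CG (2 Cf + (t + s) CL)`
  have hgen_le : ∀ n u ω, |genDrift κ n θ 0 f u ω| ≤ CL := by
    intro n u ω
    simp only [genDrift_apply, trunc_apply]
    split_ifs
    · rw [zero_mul, Real.exp_zero, one_mul, expGenerator_zero_eq_angleGenerator]; exact hCL _
    · rw [abs_zero]; exact hCL0
  have hI_le : ∀ n (r : ℝ≥0) ω, |∫ u in (0 : ℝ)..r, genDrift κ n θ 0 f u.toNNReal ω| ≤ CL * r := by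
    intro n r ω
    have h := intervalIntegral.norm_integral_le_of_norm_le_const (a := (0 : ℝ)) (b := (r : ℝ))
      (f := fun u : ℝ ↦ genDrift κ n θ 0 f u.toNNReal ω) (C := CL) fun u _ ↦ by
        rw [Real.norm_eq_abs]; exact hgen_le n _ ω
    rw [Real.norm_eq_abs, sub_zero, abs_of_nonneg r.coe_nonneg] at h
    exact h
  have hbound : ∀ n ω, |Φ n ω| ≤ CG * (2 * Cf + CL * (t + s)) := by
    intro n ω
    simp only [hΦdef]
    rw [abs_mul]
    refine mul_le_mul (hGb ω) ?_ (abs_nonneg _) hCG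
    calc _ ≤ |f (stoppedProcess (sleArgLevel κ n θ) (sleExitLevel κ n θ) t ω) -
          ∫ u in (0 : ℝ)..t, genDrift κ n θ 0 f u.toNNReal ω| +
        |f (stoppedProcess (sleArgLevel κ n θ) (sleExitLevel κ n θ) s ω) -
          ∫ u in (0 : ℝ)..s, genDrift κ n θ 0 f u.toNNReal ω| := abs_sub _ _
      _ ≤ (Cf + CL * t) + (Cf + CL * s) := by
          gcongr
          · exact (abs_sub _ _).trans (add_le_add (hCf _) (hI_le n t ω))
          · exact (abs_sub _ _).trans (add_le_add (hCf _) (hI_le n s ω))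
      _ = 2 * Cf + CL * (t + s) := by ring
  -- a.e. convergence: eventually `σₙ > t`, and then `Φₙ = Φlim`
  have hgenlim : ∀ ω n, (t : WithTop ℝ≥0) < sleExitLevel κ n θ ω → ∀ r : ℝ≥0, r ≤ t →
      ∫ u in (0 : ℝ)..r, genDrift κ n θ 0 f u.toNNReal ω =
        ∫ u in (0 : ℝ)..r, angleGenerator κ 0 f (sleArg κ θ u.toNNReal ω) := by
    intro ω n hn r hr
    refine intervalIntegral.integral_congr fun u hu ↦ ?_
    rw [uIcc_of_le r.coe_nonneg] at hu
    have hu' : ((u.toNNReal : ℝ≥0) : WithTop ℝ≥0) ≤ sleExitLevel κ n θ ω :=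
      ((WithTop.coe_le_coe.2 ((Real.toNNReal_le_iff_le_coe.2 hu.2).trans hr)).trans hn.le)
    simp only [genDrift_apply, trunc_apply, if_pos hu', zero_mul, Real.exp_zero, one_mul,
      expGenerator_zero_eq_angleGenerator, stoppedProcess_eq_of_le hu']
    congr 1
    exact (arg_eq_argLevel (continuous_sleDriving' κ) hu').symm
  have hae : ∀ᵐ ω ∂preWienerMeasure, Tendsto (fun n ↦ Φ n ω) atTop (𝓝 (Φlim ω)) := by
    filter_upwards [ae_eventually_lt_sleExitLevel hκ hθ t] with ω hω
    refine (tendsto_const_nhds (x := Φlim ω)).congr' ?_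
    filter_upwards [hω] with n hn
    have hns : (s : WithTop ℝ≥0) ≤ sleExitLevel κ n θ ω := (WithTop.coe_le_coe.2 hst).trans hn.le
    simp only [hΦdef, hΦlimdef]
    rw [hgenlim ω n hn t le_rfl, hgenlim ω n hn s hst, stoppedProcess_eq_of_le hn.le,
      stoppedProcess_eq_of_le hns]
    have ht' : sleArgLevel κ n θ t ω = sleArg κ θ t ω := (arg_eq_argLevel (continuous_sleDriving' κ) hn.le).symm
    have hs' : sleArgLevel κ n θ s ω = sleArg κ θ s ω := (arg_eq_argLevel (continuous_sleDriving' κ) hns).symm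
    rw [ht', hs']
    -- `∫₀ᵗ - ∫₀ˢ = ∫ₛᵗ`
    have hii : ∀ a b : ℝ, IntervalIntegrable (fun u : ℝ ↦ angleGenerator κ 0 f (sleArg κ θ u.toNNReal ω)) volume a b := by
      intro a b
      refine (intervalIntegrable_const (c := CL)).mono_fun' ?_ ?_
      · exact ((hLcont.measurable.comp ((measurable_sleArg_time κ θ).comp
          (measurable_real_toNNReal.prodMk measurable_const))).aestronglyMeasurable)
      · exact Eventually.of_forall fun u ↦ by simpa [Real.norm_eq_abs] using hCL _
    rw [← intervalIntegral.integral_add_adjacent_intervals (hii 0 s) (hii s t)]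
    ring
  -- dominated convergence for the means
  have hΦm : ∀ n, AEStronglyMeasurable (Φ n) preWienerMeasure := by
    intro n
    have hGm : Measurable G := hG.mono (brownianFiltration.le s) le_rfl
    have hV : ∀ r : ℝ≥0, Measurable fun ω ↦ f (stoppedProcess (sleArgLevel κ n θ) (sleExitLevel κ n θ) r ω) :=
      fun r ↦ hf.continuous.measurable.comp ((stronglyAdapted_stoppedProcess_sleArgLevel κ n θ
        (isStoppingTime_sleExitLevel κ n θ) r).measurable.mono (brownianFiltration.le r) le_rfl)
    have hI : ∀ r : ℝ≥0, Measurable fun ω ↦ ∫ u in (0 : ℝ)..r, genDrift κ n θ 0 f u.toNNReal ω :=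
      fun r ↦ (measurable_integral_genDrift hf 0 r).mono (brownianFiltration.le r) le_rfl
    exact (hGm.mul (((hV t).sub (hI t)).sub ((hV s).sub (hI s)))).aestronglyMeasurable
  have hlim := tendsto_integral_of_dominated_convergence (fun _ ↦ CG * (2 * Cf + CL * (t + s))) hΦm
    (integrable_const _) (fun n ↦ Eventually.of_forall fun ω ↦ by
      rw [Real.norm_eq_abs]; exact hbound n ω) hae
  have hlim0 : Tendsto (fun n ↦ ∫ ω, Φ n ω ∂preWienerMeasure) atTop (𝓝 0) :=
    tendsto_const_nhds.congr' (by filter_upwards [eventually_ge_atTop N₀] with n hn; exact (hzero n hn).symm)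
  exact tendsto_nhds_unique hlim hlim0

end Generator

end RadialLoewner

end Literature.Probability.RandomPlanarGeometry
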